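import Summits.Ventures.YMGap.RobustBall.FiniteGibbsInfluence
import HarnessLib

/-!
# RobustBall/FiniteGibbsInfluenceOsc — one-site influences of an exponential-sum weight with PER-TERM SECOND-DIFFERENCE constants:
# `tv ≤ (∑_{p ∋ x, y} O_p)/4`

HONEST FRAMING: elementary finite combinatorics (finite sums only, no measure theory), written for the `β`-ladder of track Y2 (cell `pub-ymgap`,
seat ds-4 g15).  It is `FiniteGibbsInfluence.tv_le_of_exp_sum` / `FiniteGibbsInfluenceW.tv_le_of_exp_sum_weighted` (a term bounded by `A_p` moves the
one-site law at `x` by at most `A_p` when the spin at `y` changes: mixed second difference `≤ 4A_p`, sharp tilt bound `tv_le_quarter_of_osc`) with the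
mixed second difference `(φ_p(τ^{x,s}) − φ_p(σ^{x,s})) − (φ_p(τ^{x,s'}) − φ_p(σ^{x,s'})) ≤ O_p` supplied PER TERM by the caller instead of `4A_p`:
`tv w x σ τ ≤ (∑_{p : x, y ∈ links p} O_p)/4`.  For `ℤ₃`-valued clock terms `a cos(2π(σ_u − σ_v)/3 + φ)` one has `O = 3a` (the `ℤ₃` chord `√3`, squared;
`ZThree.activity_double_diff_le`) against the generic `4a`, which is the source of the `SU(3)` centre-blind rung `|β| < 2/27` (`CentreBlindOscWindow`).
Nothing is specific to gauge theories; nothing is claimed about any continuum limit.  Reference: H.-O. Georgii, *Gibbs Measures and Phase Transitions*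
(2011) Prop. 8.8.
-/

noncomputable section

open Finset Function

namespace Summit.Ventures.YMGap.RobustBall

/-! ### The generic influence bound with per-term second-difference constants -/

namespace FiniteGibbs

variable {V S : Type*} [DecidableEq V] [Fintype S] [Nonempty S]

/-- **One-site influences of an exponential-sum weight, second-difference form.**  Let `w σ = exp(∑_p φ_p σ)` where each `φ_p` reads
only the spins in `links p`.  If `σ, τ` agree off `y` and, for every term through both `x` and `y`, the mixed second difference
`(φ_p(τ^{x,s}) − φ_p(σ^{x,s})) − (φ_p(τ^{x,s'}) − φ_p(σ^{x,s'})) ≤ O_p` for all `s, s'`, then `tv w x σ τ ≤ (∑_{p ∋ x, y} O_p)/4`.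
(`tv_le_of_exp_sum_weighted` is the case `O_p = 4A_p`.) [cite: Georgii2011, Prop. 8.8] -/
theorem tv_le_of_exp_sum_osc {P : Type*} [Fintype P] (links : P → Finset V) (φ : P → (V → S) → ℝ)
    (hdep : ∀ p, DependsOn (φ p) (↑(links p) : Set V)) (O : P → ℝ)
    {w : (V → S) → ℝ} (hw : ∀ σ, w σ = Real.exp (∑ p, φ p σ)) {x y : V}
    {σ τ : V → S} (hστ : ∀ z, z ≠ y → σ z = τ z)
    (hO : ∀ p, x ∈ links p → y ∈ links p → ∀ s s' : S,
      (φ p (update τ x s) - φ p (update σ x s)) - (φ p (update τ x s') - φ p (update σ x s')) ≤ O p)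
    [DecidablePred fun p => x ∈ links p ∧ y ∈ links p] :
    tv w x σ τ ≤ (∑ p ∈ Finset.univ.filter (fun p => x ∈ links p ∧ y ∈ links p), O p) / 4 := by
  have hwpos : ∀ σ, 0 < w σ := fun σ => by rw [hw]; exact Real.exp_pos _
  set Q := Finset.univ.filter fun p => x ∈ links p ∧ y ∈ links p with hQ
  -- the log-ratio of the two conditional weights
  set h : S → ℝ := fun s => ∑ p, (φ p (update τ x s) - φ p (update σ x s)) with hh
  have hwh : ∀ s, w (update τ x s) = w (update σ x s) * Real.exp (h s) := fun s => by
    rw [hw, hw, ← Real.exp_add]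
    congr 1
    rw [hh]; dsimp only
    rw [Finset.sum_sub_distrib]; ring
  -- terms through both sites: the given second differences; other terms: constant in `s`
  have hterm : ∀ (p : P) (s s' : S),
      (φ p (update τ x s) - φ p (update σ x s)) - (φ p (update τ x s') - φ p (update σ x s')) ≤
        if x ∈ links p ∧ y ∈ links p then O p else 0 := by
    intro p s s'
    split_ifs with hp
    · exact hO p hp.1 hp.2 s s'
    · rw [not_and_or] at hp
      rcases hp with hx | hy
      · have hzx : ∀ z ∈ (↑(links p) : Set V), z ≠ x := fun z hz h => hx (h ▸ Finset.mem_coe.1 hz)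
        have eτ : φ p (update τ x s) = φ p (update τ x s') :=
          hdep p fun z hz => by rw [update_of_ne (hzx z hz), update_of_ne (hzx z hz)]
        have eσ : φ p (update σ x s) = φ p (update σ x s') :=
          hdep p fun z hz => by rw [update_of_ne (hzx z hz), update_of_ne (hzx z hz)]
        rw [eτ, eσ]; simp
      · have e1 : φ p (update τ x s) = φ p (update σ x s) :=
          hdep p fun z hz => (update_agree_of_agree hστ s z (fun h => hy (h ▸ Finset.mem_coe.1 hz))).symm
        have e2 : φ p (update τ x s') = φ p (update σ x s') :=
          hdep p fun z hz => (update_agree_of_agree hστ s' z (fun h => hy (h ▸ Finset.mem_coe.1 hz))).symm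
        rw [e1, e2]; simp
  have hD : ∀ s s', h s - h s' ≤ ∑ p ∈ Q, O p := by
    intro s s'
    have hsum : ∑ p, ((φ p (update τ x s) - φ p (update σ x s)) - (φ p (update τ x s') - φ p (update σ x s')))
        ≤ ∑ p, (if x ∈ links p ∧ y ∈ links p then O p else 0) :=
      Finset.sum_le_sum fun p _ => hterm p s s'
    rw [Finset.sum_ite, Finset.sum_const_zero, add_zero, ← hQ] at hsum
    have hhs : h s - h s' = ∑ p, ((φ p (update τ x s) - φ p (update σ x s)) -
        (φ p (update τ x s') - φ p (update σ x s'))) := by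
      rw [hh]; dsimp only; rw [← Finset.sum_sub_distrib]
    rw [hhs]
    exact hsum
  exact tv_le_quarter_of_osc hwpos x σ τ hD hwh

end FiniteGibbs

end Summit.Ventures.YMGap.RobustBall

end
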